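import Summits.AnomalousDissipation.AnomalousDissipation.Theses.Sparks

/-!
# Birth skeleton (BC3) — crux `Sparks.UniformIgnition` (stmt-AnomalousDissipation-14547)

Route `AnomalousDissipation/Sparks` (`closes : SingularitiesDissipate → UniformIgnition → RecurrentBlowupBall
→ IgnitionReturnGlue → Assembly → AnomalousDissipation`), item stmt-AnomalousDissipation-14547, crux rank 5,
difficulty XL: for a smooth steady divergence-free mean-zero force `f`, a smooth divergence-free state
`U₀` and radii `0 < δ₂ < δ₁` — IF every smooth divergence-free `V` with `‖V − U₀‖₂ ≤ δ₁` IGNITES (own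
quantum `q_V > 0`, window `Tb_V`, viscosity threshold `ν_V`, radius `δ_V`: every global Leray–Hopf
solution of `NS_ν(f)`, `ν < ν_V`, from a finite-energy datum `δ_V`-close to `V` in `L²` burns
`ν ∫₀^{Tb_V} ‖∇u‖₂² ≥ q_V`), THEN one `(q, Tb, ν₀)` serves every finite-energy datum within `δ₂` of `U₀`.
Skeleton registrar planner-skel-stmt-AnomalousDissipation-14547-0, 2026-08-17 (route re-audit bin
REPAIRABLE; `Cruxes/UniformIgnition/` had no workfile before this one).

## What the landed Negative lemma forces on any line

`Theorems/UniformIgnition/Negative/SchemaFalse.lean` (`uniformIgnition_schema_false`, refuter gen-2, landed):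
the ABSTRACT pointwise ⇒ uniform schema of the crux is false (`X = ℝ`, smooth data `= ℚ`,
`burn x = |x − (√2−1)|`: every rational ignites, radius = quantum `= |V − a|/2 → 0` at the rough point `a`).
Hence no covering / compactness / semicontinuity argument over the smooth data proves the crux; a proof
must say which Navier–Stokes mechanism keeps the ignition constants `(q_V, Tb_V, ν_V, δ_V)` from
degenerating along smooth centres `V` that converge only WEAKLY (e.g. `U₀ + δ₂·(high-frequency packet)`):
on every finite-dimensional (band-limited) family of centres the constants ARE uniform by compactness
(finite subcover of the closed bounded set of Galerkin truncations — the known first lemma of both bets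
below), so the whole difficulty sits on centres escaping every truncation.

## The line of this skeleton: ENERGETIC FLOOR × KINEMATIC UNIFORMITY × SMOOTH APPROXIMATION

The four ignition constants degenerate in two physically different ways, and the seam separates them:
* `stub_quantumFloor` (ENERGETIC non-degeneration; NS-specific BET, size XL). Pointwise ignition on the
  `δ₁`-ball ⇒ ONE quantum `q⋆ > 0` valid at every smooth divergence-free centre of the closed `δ₂`-ball
  (window, threshold and radius still centre-dependent): "the Onsager quantum of the singular events does
  not evaporate deep inside blow-up territory". Exactly the degeneration exhibited by `SchemaFalse`
  (`q_V → 0`), so it is not formal; physically it is the statement that a high-frequency packet of FIXED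
  energy riding on a blow-up datum cannot defuse the burst below a fixed fraction of its budget
  (Onsager/Duchon–Robert local energy balance at the singular event, DrivasEyink2019 Lemma 1; against it:
  escape to `k = ∞` without burn, Cheskidov2023 Thm 2.1, and shear-type selection, BardosTitiWiedemann2012).
* `stub_uniformAtFloor` (KINEMATIC non-degeneration GIVEN an energetic floor; NS-specific BET, size XL).
  Pointwise ignition on the `δ₁`-ball AND a quantum floor on every closed `δ₃`-ball, `δ₃ < δ₁` ⇒ ONE
  `(q, Tb, ν₀, δ)` igniting every smooth divergence-free centre of the closed `δ₂`-ball with the SAME radius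
  `δ`: burn windows, viscosity thresholds and robustness radii are uniform once the quantum is. Also not
  formal (toy model `burn = 1` off one rough point, `= 0` at it: floor `q⋆ = 1` everywhere, radii `→ 0`), so
  it too needs NS structure: the time to blow up and burn is controlled deep inside the ball (in the route,
  `RecurrentBlowupBall` pins ONE breakdown time `T` for the whole `δ₁`-ball and `SingularitiesDissipate`
  adds a delay `τ_V`; the bet is `sup τ_V < ∞`, `inf ν_V > 0`, `inf δ_V > 0` at a fixed quantum level —
  pre-blow-up `L²`-tracking by the relative-energy engine `WindowStability`, BrueDeLellisCMP2023 App.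
  Lemma 7 / BrenierDeLellisSzekelyhidi2011 Cor. 1, transports robustness radii along classical Euler arcs).
* `stub_smoothApprox` (TRUE, size M–L in Lean; pure function-space analysis on `T³`). Every finite-energy
  datum of a global Leray–Hopf solution lying in the closed `L²`-ball `B̄(U₀, r)` around a smooth
  divergence-free `U₀` is, for every `ε > 0`, `ε`-close in `L²` to a smooth divergence-free `V` of the SAME
  closed ball. Proof in print: the datum is weakly divergence free (`IsLerayHopfOn.weak` gives weakly
  div-free slices for a.e. `t`, `strong_initial` gives `u(t) → u₀` in `L²`, and `∫⟪·, ∇θ⟫` is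
  `L²`-continuous); Fourier truncation `P_N u₀` is a real trigonometric polynomial (smooth), divergence free
  (`k · û₀(k) = 0` from weak divergence-freeness tested against `e^{-2πik·x}`), and `P_N u₀ → u₀` in `L²`
  (Plancherel on `UnitAddTorus (Fin 3)`); finally retract towards the centre, `V = U₀ + λ(Ṽ − U₀)`,
  `λ = r/(r+ε')`, to stay inside the closed ball (`IsSmooth`, `IsDivFree` are stable under affine
  combinations; `eLpNorm` triangle inequality). Sources: Temam, NS Ch. I §1.4 (space `H`, density);
  RobinsonRodrigoSadowski2016 Thm 2.26; tree `Torus.IsWeaklyDivFree`, `Torus.eHomSobolevSeminorm`.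

Composition `UniformIgnition_of` (sorry-free): quantum floors on every `δ₃`-ball from stub 1; uniform
`(q, Tb, ν₀, δ)` on the smooth centres of the `δ₂`-ball from stub 2; a rough datum `u₀ ∈ B̄(U₀, δ₂)` is
`δ`-close to a smooth divergence-free centre `V ∈ B̄(U₀, δ₂)` by stub 3, and ignition at `V` with radius `δ`
covers it. The conclusion is the route decl `Sparks.UniformIgnition` BY NAME (its hypothesis is
`PointwiseIgnition f U₀ δ₁` and its conclusion `∃ q Tb ν₀, … ∧ Ignites f U₀ q Tb ν₀ δ₂`, definitionally).

Necessity (why neither bet overshoots the crux): `UniformIgnition` at the intermediate radius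
`δ₂' = (δ₁+δ₂)/2` gives `(q, Tb, ν₀)` on `B̄(U₀, δ₂')`, hence ignition of every smooth centre of
`B̄(U₀, δ₂)` with the common radius `δ₂' − δ₂` (triangle inequality) — i.e. the conclusions of BOTH
stubs 1 and 2. So, modulo the true stub 3, `UniformIgnition ⟺ stub 1 ∧ stub 2`, and each bet is a
genuine half: stub 1 alone leaves windows/thresholds/radii free, stub 2 alone has an undischarged floor
hypothesis (open — it presupposes robust anomalous dissipation somewhere, like the crux's own hypothesis).

## Disproof / negatives honoured

No `Cruxes/UniformIgnition/Disproof.lean` exists (`ledger crux ls stmt-AnomalousDissipation-14547`: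
"no workfiles yet", 2026-08-17) — no `_false_without_` theorem to cite. Honoured instead: the landed
`Theorems/UniformIgnition/Negative/SchemaFalse.lean` (both bets are typed so that the schema counterexample
is visibly the failure of stub 1, and its indicator variant the failure of stub 2; neither stub is an
instance the lemma refutes, since both keep the full NS hypotheses), and the two refuter crux-attack
stamps (gen-1/gen-2: survives; `MemLp u₀ 2 volume` binder and the open burn window `(0, Tb)` seal the
non-measurable-datum and `t = 0`-slice junk — all three stubs keep exactly those binders).

## BC3 audit (this seat; raw outputs under `birth-certificate:` in the seat's NOTES.md)

See `Lines/birth.md`: `lean check --json` rc 0 with `sorries = 3` = the three `theorem stub_*`, zero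
elsewhere; probes `stub → UniformIgnition` and `stub → AnomalousDissipation` by
`first | exact? | simpa | simpa [UniformIgnition] | (unfold UniformIgnition; simpa) | aesop` FAIL for all
three stubs (seat file `bc/UniformIgnition_stub_probes.lean`, §0–§1 copied, no sorried theorem in scope).

Shape (D-0027 §3.3, as `Cruxes/DeepSubBallisticFrames/Lines/birth.lean`): signatures `Sig.stub_<name> :
Prop`, registered stubs `theorem stub_<name> : Sig.stub_<name> := by sorry`, composition
`UniformIgnition_of : Sig.stub_quantumFloor → Sig.stub_uniformAtFloor → Sig.stub_smoothApprox →
UniformIgnition` (sorry-free) and `UniformIgnition_proof`.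
-/

set_option linter.dupNamespace false

noncomputable section

namespace Summit.AnomalousDissipation.AnomalousDissipation.Cruxes.UniformIgnition.Birth

open MeasureTheory Set Filter Topology
open Summit.AnomalousDissipation.AnomalousDissipation.Theses.Sparks

/-- The flat three-torus (local notation). -/
local notation "𝕋³" => UnitAddTorus (Fin 3)
/-- Velocity values (local notation). -/
local notation "E³" => EuclideanSpace ℝ (Fin 3)

/-! ### §0 Vocabulary of the seam (transparent `def`s over tree declarations) -/

/-- **Ignition of a centre.** `Ignites f V q Tb ν₀ δ`: every global Leray–Hopf solution of `NS_ν`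
forced by the steady force `f`, `0 < ν < ν₀`, from a finite-energy datum `δ`-close to `V` in `L²`
burns at least `q` on the window `(0, Tb)`: `q ≤ ν ∫₀^{Tb} ‖∇u‖₂²` (spectral `Torus.eGradNormSq`).
VERBATIM the inner block of the crux, both in its hypothesis (at `V` with `(q_V, Tb_V, ν_V, δ_V)`) and in
its conclusion (at `U₀` with `(q, Tb, ν₀, δ₂)`). -/
def Ignites (f V : 𝕋³ → E³) (q Tb ν₀ δ : ℝ) : Prop :=
  ∀ (ν : ℝ) (u₀ : 𝕋³ → E³) (u : ℝ → 𝕋³ → E³), 0 < ν → ν < ν₀ →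
    Literature.Analysis.FluidPDE.Torus.IsGlobalLerayHopf ν (fun _ => f) u₀ u →
    MeasureTheory.MemLp u₀ 2 MeasureTheory.volume →
    MeasureTheory.eLpNorm (u₀ - V) 2 MeasureTheory.volume ≤ ENNReal.ofReal δ →
      q ≤ ν * (MeasureTheory.lintegral (MeasureTheory.Measure.restrict MeasureTheory.volume (Set.Ioo 0 Tb))
        (fun t => Literature.Analysis.FunctionSpaces.Torus.eGradNormSq (u t))).toReal

/-- **Pointwise ignition on the closed `δ₁`-ball** — VERBATIM the hypothesis of the crux: every smooth
divergence-free `V` with `‖V − U₀‖₂ ≤ δ₁` ignites with its own positive constants. -/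
def PointwiseIgnition (f U₀ : 𝕋³ → E³) (δ₁ : ℝ) : Prop :=
  ∀ V : 𝕋³ → E³, Literature.Analysis.FunctionSpaces.Torus.IsSmooth V →
    Literature.Analysis.FunctionSpaces.Torus.IsDivFree V →
    MeasureTheory.eLpNorm (V - U₀) 2 MeasureTheory.volume ≤ ENNReal.ofReal δ₁ →
      ∃ (q Tb ν₀ δ : ℝ), 0 < q ∧ 0 < Tb ∧ 0 < ν₀ ∧ 0 < δ ∧ Ignites f V q Tb ν₀ δ

/-- **Quantum floor on the closed `δ₃`-ball at level `q`**: every smooth divergence-free centre of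
`B̄(U₀, δ₃)` ignites with quantum `q` (window, threshold, radius still centre-dependent). -/
def QuantumFloorOn (f U₀ : 𝕋³ → E³) (δ₃ q : ℝ) : Prop :=
  ∀ V : 𝕋³ → E³, Literature.Analysis.FunctionSpaces.Torus.IsSmooth V →
    Literature.Analysis.FunctionSpaces.Torus.IsDivFree V →
    MeasureTheory.eLpNorm (V - U₀) 2 MeasureTheory.volume ≤ ENNReal.ofReal δ₃ →
      ∃ (Tb ν₀ δ : ℝ), 0 < Tb ∧ 0 < ν₀ ∧ 0 < δ ∧ Ignites f V q Tb ν₀ δ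

/-- **Uniform ignition of the smooth centres of the closed `δ₂`-ball** with ONE set of constants
`(q, Tb, ν₀, δ)`, radius included. -/
def UniformOnSmoothCentres (f U₀ : 𝕋³ → E³) (δ₂ q Tb ν₀ δ : ℝ) : Prop :=
  ∀ V : 𝕋³ → E³, Literature.Analysis.FunctionSpaces.Torus.IsSmooth V →
    Literature.Analysis.FunctionSpaces.Torus.IsDivFree V →
    MeasureTheory.eLpNorm (V - U₀) 2 MeasureTheory.volume ≤ ENNReal.ofReal δ₂ →
      Ignites f V q Tb ν₀ δ

/-! ### §1 Signatures of the registered stubs (by name; D-0027 §3.3 shape) -/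

/-- STUB 1 — **QUANTUM FLOOR** (energetic non-degeneration; NS-specific bet, XL). For `f` smooth
divergence-free mean-zero, `U₀` smooth divergence-free and `0 < δ₂ < δ₁`: pointwise ignition on the closed
`δ₁`-ball ⇒ ONE quantum `q⋆ > 0` at which every smooth divergence-free centre of the closed `δ₂`-ball
ignites (its window, threshold and radius may still depend on the centre). A CONSEQUENCE of the crux
(apply it at `δ₂' = (δ₁+δ₂)/2`, radius `δ₂' − δ₂`), strictly weaker in intent: it says nothing about
windows/thresholds/radii. Not formal: it is exactly what fails in the schema counterexample
`Theorems/UniformIgnition/Negative/SchemaFalse.lean` (`q_V → 0` towards a rough datum). Known part: on every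
band-limited family of centres (Galerkin truncations of level `N`, a compact set) a floor follows from
pointwise ignition by a finite subcover; the bet is the floor along centres escaping every truncation
(`U₀ +` high-frequency packets of energy up to `δ₂²`). Why it might fail: packets that are Euler-tame
(shear/Beltrami-type, BardosTitiWiedemann2012 selection) and defuse the burst of `U₀`, burning only their
own `O(ν)`; escape to `k = ∞` without burn (Cheskidov2023 Thm 2.1). Sources: DrivasEyink2019 Lemma 1,
Cheskidov2023 Thm 2.1, BardosTitiWiedemann2012, Constantin1986 (route header of Sparks, crux #5). -/
def Sig.stub_quantumFloor : Prop :=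
  ∀ f : 𝕋³ → E³, Literature.Analysis.FunctionSpaces.Torus.IsSmooth f →
    Literature.Analysis.FunctionSpaces.Torus.IsDivFree f →
    Literature.Analysis.FunctionSpaces.Torus.HasZeroMean f →
    ∀ U₀ : 𝕋³ → E³, Literature.Analysis.FunctionSpaces.Torus.IsSmooth U₀ →
      Literature.Analysis.FunctionSpaces.Torus.IsDivFree U₀ →
      ∀ (δ₁ δ₂ : ℝ), 0 < δ₂ → δ₂ < δ₁ → PointwiseIgnition f U₀ δ₁ →
        ∃ q : ℝ, 0 < q ∧ QuantumFloorOn f U₀ δ₂ q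

/-- STUB 2 — **UNIFORMITY AT A FLOOR** (kinematic non-degeneration; NS-specific bet, XL). For `f`, `U₀`,
`0 < δ₂ < δ₁` as above: pointwise ignition on the closed `δ₁`-ball together with a quantum floor on EVERY
closed `δ₃`-ball, `0 < δ₃ < δ₁` (the output of stub 1 at all radii) ⇒ ONE `(q, Tb, ν₀, δ)` igniting every
smooth divergence-free centre of the closed `δ₂`-ball with the common radius `δ`. Also a CONSEQUENCE of the
crux (same intermediate-radius argument), and also not formal (toy model: burn `1` off one rough point and
`0` at it — floor `1` everywhere, radii `→ 0`), so the floor hypothesis is load-bearing only through NS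
structure: at a fixed quantum level the burn TIME, viscosity THRESHOLD and robustness RADIUS are controlled
deep inside the ball — in the route's picture one breakdown time `T` for the whole `δ₁`-ball
(`RecurrentBlowupBall`) plus delays `τ_V` (`SingularitiesDissipate`), and pre-blow-up `L²`-tracking by the
relative-energy engine (`WindowStability`: BrueDeLellisCMP2023 App. Lemma 7, BrenierDeLellisSzekelyhidi2011
Cor. 1) transporting radii along classical Euler arcs. Why it might fail: `sup_V τ_V = ∞` (ever later
bursts along rougher centres), `inf_V ν_V = 0` (viscous defusing at moderate `ν`), or `inf_V δ_V = 0` at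
fixed quantum (the indicator toy model realised by NS). Sources: BrueDeLellisCMP2023 App. Lemma 7,
BrenierDeLellisSzekelyhidi2011 Cor. 1, Cheskidov2023 Thm 2.1, DrivasEyink2019. -/
def Sig.stub_uniformAtFloor : Prop :=
  ∀ f : 𝕋³ → E³, Literature.Analysis.FunctionSpaces.Torus.IsSmooth f →
    Literature.Analysis.FunctionSpaces.Torus.IsDivFree f →
    Literature.Analysis.FunctionSpaces.Torus.HasZeroMean f →
    ∀ U₀ : 𝕋³ → E³, Literature.Analysis.FunctionSpaces.Torus.IsSmooth U₀ →
      Literature.Analysis.FunctionSpaces.Torus.IsDivFree U₀ →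
      ∀ (δ₁ δ₂ : ℝ), 0 < δ₂ → δ₂ < δ₁ → PointwiseIgnition f U₀ δ₁ →
        (∀ δ₃ : ℝ, 0 < δ₃ → δ₃ < δ₁ → ∃ q : ℝ, 0 < q ∧ QuantumFloorOn f U₀ δ₃ q) →
        ∃ (q Tb ν₀ δ : ℝ), 0 < q ∧ 0 < Tb ∧ 0 < ν₀ ∧ 0 < δ ∧ UniformOnSmoothCentres f U₀ δ₂ q Tb ν₀ δ

/-- STUB 3 — **SMOOTH DIVERGENCE-FREE APPROXIMATION INSIDE A CLOSED BALL** (TRUE; size M–L in Lean). A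
finite-energy datum `u₀` of a global Leray–Hopf solution (any viscosity `ν > 0`, any force) lying in the
closed `L²`-ball of radius `r > 0` around a smooth divergence-free `U₀` is, for every `ε > 0`, `ε`-close in
`L²` to a smooth divergence-free `V` of the SAME closed ball. Proof in print: `u₀` is weakly divergence
free (a.e. slice of `IsLerayHopfOn.weak` is, `strong_initial`, `L²`-continuity of `∫⟪·, ∇θ⟫`); Fourier
truncations `P_N u₀` are real trigonometric polynomials, smooth and divergence free (`k · û₀(k) = 0`), with
`P_N u₀ → u₀` in `L²` (Plancherel on `𝕋³`); retract towards `U₀` (`V = U₀ + λ(P_N u₀ − U₀)`,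
`λ = r/(r + ε/2)`) to stay in the closed ball; `IsSmooth`/`IsDivFree` are stable under affine combinations.
Why it might fail: it should not (the Lean cost is the Fourier/Plancherel bookkeeping for
`EuclideanSpace`-valued fields on `UnitAddTorus (Fin 3)` and the weak-divergence test against characters).
Sources: Temam, *Navier–Stokes Equations* Ch. I §1.4; RobinsonRodrigoSadowski2016 Thm 2.26; tree
`Torus.IsWeaklyDivFree`, `Torus.IsLerayHopfOn.strong_initial`, `IsWeakNSSolutionForcedOn.ae_isWeaklyDivFree`. -/
def Sig.stub_smoothApprox : Prop :=
  ∀ (ν : ℝ) (f : ℝ → 𝕋³ → E³) (u₀ : 𝕋³ → E³) (u : ℝ → 𝕋³ → E³), 0 < ν →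
    Literature.Analysis.FluidPDE.Torus.IsGlobalLerayHopf ν f u₀ u →
    MeasureTheory.MemLp u₀ 2 MeasureTheory.volume →
    ∀ U₀ : 𝕋³ → E³, Literature.Analysis.FunctionSpaces.Torus.IsSmooth U₀ →
      Literature.Analysis.FunctionSpaces.Torus.IsDivFree U₀ →
      ∀ (r ε : ℝ), 0 < r → 0 < ε →
        MeasureTheory.eLpNorm (u₀ - U₀) 2 MeasureTheory.volume ≤ ENNReal.ofReal r →
          ∃ V : 𝕋³ → E³, Literature.Analysis.FunctionSpaces.Torus.IsSmooth V ∧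
            Literature.Analysis.FunctionSpaces.Torus.IsDivFree V ∧
            MeasureTheory.eLpNorm (V - U₀) 2 MeasureTheory.volume ≤ ENNReal.ofReal r ∧
            MeasureTheory.eLpNorm (u₀ - V) 2 MeasureTheory.volume ≤ ENNReal.ofReal ε

/-! ### §2 Registered stubs (the only `sorry`s of the file) -/

/-- Registered stub 1 — quantum floor (energetic non-degeneration; bet). -/
theorem stub_quantumFloor : Sig.stub_quantumFloor := by
  sorry

/-- Registered stub 2 — uniformity at a floor (kinematic non-degeneration; bet; hardest). -/
theorem stub_uniformAtFloor : Sig.stub_uniformAtFloor := by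
  sorry

/-- Registered stub 3 — smooth divergence-free approximation inside a closed ball (theorem-grade;
claimable now). -/
theorem stub_smoothApprox : Sig.stub_smoothApprox := by
  sorry

/-! ### §3 Composition (kernel-checked; no `sorry` outside the three stubs) -/

/-- **The skeleton closes the crux BY NAME**: `Sig.stub_quantumFloor → Sig.stub_uniformAtFloor →
Sig.stub_smoothApprox → Sparks.UniformIgnition`. Floors on every `δ₃`-ball (stub 1) ⇒ uniform
`(q, Tb, ν₀, δ)` on the smooth centres of the `δ₂`-ball (stub 2) ⇒ a rough admissible datum in
`B̄(U₀, δ₂)` is `δ`-close to such a centre (stub 3) and is covered by its ignition ball. -/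
theorem UniformIgnition_of :
    Sig.stub_quantumFloor → Sig.stub_uniformAtFloor → Sig.stub_smoothApprox → UniformIgnition := by
  intro hQ hW hD f hf hdf hmf U₀ hU₀ hdU₀ δ₁ δ₂ hδ₂ hδ₂₁ hHyp
  -- the crux hypothesis is `PointwiseIgnition f U₀ δ₁`, definitionally
  have hP : PointwiseIgnition f U₀ δ₁ := hHyp
  -- Stub 1 at every radius `δ₃ < δ₁`: quantum floors.
  have hfloor : ∀ δ₃ : ℝ, 0 < δ₃ → δ₃ < δ₁ → ∃ q : ℝ, 0 < q ∧ QuantumFloorOn f U₀ δ₃ q :=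
    fun δ₃ h₃ h₃₁ => hQ f hf hdf hmf U₀ hU₀ hdU₀ δ₁ δ₃ h₃ h₃₁ hP
  -- Stub 2: uniform constants, radius included, on the smooth centres of the closed `δ₂`-ball.
  obtain ⟨q, Tb, ν₀, δ, hq, hTb, hν₀, hδ, hunif⟩ :=
    hW f hf hdf hmf U₀ hU₀ hdU₀ δ₁ δ₂ hδ₂ hδ₂₁ hP hfloor
  refine ⟨q, Tb, ν₀, hq, hTb, hν₀, ?_⟩
  intro ν u₀ u hν hνν₀ hLH hMem hdist
  -- Stub 3: a smooth divergence-free centre of the same closed ball, `δ`-close to the datum.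
  obtain ⟨V, hVs, hVd, hVU₀, hu₀V⟩ :=
    hD ν (fun _ => f) u₀ u hν hLH hMem U₀ hU₀ hdU₀ δ₂ δ hδ₂ hδ hdist
  exact hunif V hVs hVd hVU₀ ν u₀ u hν hνν₀ hLH hMem hu₀V

/-- The skeleton in its final shape (D-0027 §3.3): the crux BY NAME from the three registered stubs; it
becomes the crux proof when the last `stub_*` is discharged (until then it depends on `sorryAx` through
the stubs only — no `sorry` of its own). -/
theorem UniformIgnition_proof : UniformIgnition :=
  UniformIgnition_of stub_quantumFloor stub_uniformAtFloor stub_smoothApprox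

end Summit.AnomalousDissipation.AnomalousDissipation.Cruxes.UniformIgnition.Birth

end
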